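import Literature.MathematicalPhysics.QuantumLattice.LiebWuEnergyAtFilling
import Literature.MathematicalPhysics.QuantumLattice.LiebWuSourcePositivity
import HarnessLib

/-!
# Monotonicity in the cutoff: Lieb–Wu 2003, Lemma 3, Lemma 4 and Theorem 3 at `B = ∞`

Family `hubbard`. Lieb–Wu, PRL 20 (1968) 1445, statement (c): "`N/N_a` is a monotonically increasing
function of `Q`, reaching `1` at `Q = π`" = Lieb–Wu, Physica A 321 (2003) 1 = arXiv:cond-mat/0207529,
§5: LEMMA 3 ("for all `Q ≤ π` and all `|k| ≤ π`, `ρ(k) > 0`"), LEMMA 4 ("as `Q` increases, `σ(Λ)`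
increases for all real `Λ`") and THEOREM 3 ("When `Q` increases with fixed `B`, `N/N_a` and `M/N_a`
increase. When `Q = π`, `N/N_a = 1`, while `N/N_a < 1` if `Q < π`"), here at `B = ∞`, for the
Neumann-series solution `σ_Q = liebWuSigmaAt U Q`, `ρ_Q = liebWuRhoAt U Q`, `n(Q) = liebWuFillingAtCutoff U Q`
(`U > 0`, `0 < Q ≤ π`). PROVED, from `LiebWuSourcePositivity` (source `s > 0` under `σ_R ≤ σ₀`;
`δ - Ŵδ ≥ 0 ⇒ δ ≥ 0`):

* `liebWuSigmaAt_le_of_lt` (one step: `σ_R ≤ σ₀ ⇒ σ_P ≤ σ_R`, `∫σ_P < ∫σ_R` for `P < R`), applied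
  first with `R = π` (`σ_π = σ₀`): `liebWuSigmaAt_le_liebWuSigma0` (`σ_Q ≤ σ₀`), then in general:
  `liebWuSigmaAt_mono` (**Lemma 4**, `σ`-part); `liebWuRhoAt_pos` (**Lemma 3** at `B = ∞`:
  `ρ_Q(k) ≥ ρ₀(k) > 0` where `cos k ≤ 0`);
* `liebWuFillingAtCutoff_strictMonoOn` (**Theorem 3** at `B = ∞`): `Q ↦ N/N_a = 2∫σ_Q` is strictly
  increasing on `(0, π]` (so is `M/N_a = ½N/N_a`); `liebWuFillingAtCutoff_lt_one` (`N/N_a < 1` for `Q < π`);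
* consequences: the cutoff at density `n` is unique (`liebWuCutoffAtFilling_eq_of_filling_eq`),
  `IsLiebWuEnergyAt.density_mem_Ioc`, and `isLiebWuEnergyAt_iff_eq_liebWuEnergyAtFilling`:
  for `0 < n ≤ 1`, `IsLiebWuEnergyAt U n e ↔ e = liebWuEnergyAtFilling U n` — **the Lieb–Wu energy at
  density `n` is a single real number**, `liebWuEnergyAtFilling U n`.

No definition, no named fact.

## References

* E. H. Lieb, F. Y. Wu, Physica A 321 (2003) 1–27 = arXiv:cond-mat/0207529, §5, Lemmas 3–4, Theorem 3
  (key `LiebWuPhysicaA2003`); PRL 20 (1968) 1445, statements (a)–(c) (key `LiebWuPRL1968`).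
-/

noncomputable section

open MeasureTheory Set Real Filter intervalIntegral
open Literature.Analysis.SpecialFunctions Literature.Analysis.FunctionSpaces

namespace Literature.MathematicalPhysics.QuantumLattice

section Monotone

variable {U P R Q : ℝ}

/-- **One monotonicity step:** for `0 < P < R ≤ π`, if `σ_R ≤ σ₀` then `σ_P ≤ σ_R` pointwise and
`∫σ_P < ∫σ_R`. [cite: LiebWuPhysicaA2003, §5, Lemma 4 and Theorem 3] -/
theorem liebWuSigmaAt_le_of_lt (hU : 0 < U) (hP : 0 < P) (hPR : P < R) (hRπ : R ≤ π)
    (hR : ∀ t, liebWuSigmaAt U R t ≤ liebWuSigma0 U t) :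
    (∀ x, liebWuSigmaAt U P x ≤ liebWuSigmaAt U R x) ∧
      ∫ x, liebWuSigmaAt U P x < ∫ x, liebWuSigmaAt U R x := by
  have hR0 : 0 < R := hP.trans hPR
  have hσRi := integrable_liebWuSigmaAt hU hR0
  have hσPi := integrable_liebWuSigmaAt hU hP
  have hσR0 : ∀ t, 0 ≤ liebWuSigmaAt U R t := fun t => (liebWuSigmaAt_pos hU hR0 t).le
  have hδc : Continuous fun x => liebWuSigmaAt U R x - liebWuSigmaAt U P x :=
    (continuous_liebWuSigmaAt hU hR0).sub (continuous_liebWuSigmaAt hU hP)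
  have hδi : Integrable fun x => liebWuSigmaAt U R x - liebWuSigmaAt U P x := hσRi.sub hσPi
  obtain ⟨hξRi, -⟩ := integrable_liebWuXi_and_integral hU hR0
  obtain ⟨hξPi, -⟩ := integrable_liebWuXi_and_integral hU hP
  obtain ⟨-, -, hWRi, -⟩ := liebWuW_props (Q := R) hU hσRi hσR0
  obtain ⟨-, -, hWPi, -⟩ := liebWuW_props (Q := P) hU hσRi hσR0
  -- the fixed-point relation `δ - Ŵ_P δ = s`
  have hsrc : ∀ x, (liebWuSigmaAt U R x - liebWuSigmaAt U P x) -
      liebWuW U P (fun t => liebWuSigmaAt U R t - liebWuSigmaAt U P t) x =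
      liebWuXi U R x - liebWuXi U P x +
        (liebWuW U R (liebWuSigmaAt U R) x - liebWuW U P (liebWuSigmaAt U R) x) := by
    intro x
    rw [← liebWuW_sub hU P hσRi hσPi, liebWuSigmaAt_eq_xi_add_W hU hR0 x,
      liebWuSigmaAt_eq_xi_add_W hU hP x]
    ring
  have hspos : ∀ x, 0 < liebWuXi U R x - liebWuXi U P x +
      (liebWuW U R (liebWuSigmaAt U R) x - liebWuW U P (liebWuSigmaAt U R) x) :=
    fun x => liebWu_source_pos hU hP hPR hRπ hσRi hσR0 hR x
  have hδ0 : ∀ x, 0 ≤ liebWuSigmaAt U R x - liebWuSigmaAt U P x :=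
    nonneg_of_sub_liebWuW_nonneg hU P hδc hδi (fun x => by rw [hsrc x]; exact (hspos x).le)
  refine ⟨fun x => sub_nonneg.1 (hδ0 x), ?_⟩
  obtain ⟨-, hWδ0, -, -, -⟩ := liebWuW_props (Q := P) hU hδi hδ0
  have hsi : Integrable fun x => liebWuXi U R x - liebWuXi U P x +
      (liebWuW U R (liebWuSigmaAt U R) x - liebWuW U P (liebWuSigmaAt U R) x) :=
    (hξRi.sub hξPi).add (hWRi.sub hWPi)
  have hint : 0 < ∫ x, (liebWuXi U R x - liebWuXi U P x +
      (liebWuW U R (liebWuSigmaAt U R) x - liebWuW U P (liebWuSigmaAt U R) x)) := by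
    refine (integral_pos_iff_support_of_nonneg (fun x => (hspos x).le) hsi).2 ?_
    have hsupp : Function.support (fun x => liebWuXi U R x - liebWuXi U P x +
        (liebWuW U R (liebWuSigmaAt U R) x - liebWuW U P (liebWuSigmaAt U R) x)) = univ :=
      eq_univ_of_forall fun x => Function.mem_support.2 (hspos x).ne'
    rw [hsupp, Real.volume_univ]
    simp
  have hmono := integral_mono hsi hδi fun x => by
    have h1 := hsrc x
    have h2 := hWδ0 x
    linarith
  rw [integral_sub hσRi hσPi] at hmono
  linarith

/-- **`σ_Q ≤ σ₀`** (`= σ_π`) pointwise, for every `0 < Q ≤ π`. [cite: LiebWuPhysicaA2003, §5, Lemma 4] -/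
theorem liebWuSigmaAt_le_liebWuSigma0 (hU : 0 < U) (hQ : 0 < Q) (hQπ : Q ≤ π) (t : ℝ) :
    liebWuSigmaAt U Q t ≤ liebWuSigma0 U t := by
  rcases eq_or_lt_of_le hQπ with h | h
  · rw [h, liebWuSigmaAt_pi hU]
  · have hπσ : ∀ s, liebWuSigmaAt U π s ≤ liebWuSigma0 U s := fun s => by rw [liebWuSigmaAt_pi hU]
    have := (liebWuSigmaAt_le_of_lt hU hQ h le_rfl hπσ).1 t
    rwa [liebWuSigmaAt_pi hU] at this

/-- **Lemma 4 (`σ`-part) at `B = ∞`: `σ_Q(Λ)` increases with `Q`** for every real `Λ`.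
[cite: LiebWuPhysicaA2003, §5, Lemma 4] -/
theorem liebWuSigmaAt_mono (hU : 0 < U) (hP : 0 < P) (hPR : P ≤ R) (hRπ : R ≤ π) (x : ℝ) :
    liebWuSigmaAt U P x ≤ liebWuSigmaAt U R x := by
  rcases eq_or_lt_of_le hPR with h | h
  · rw [h]
  · exact (liebWuSigmaAt_le_of_lt hU hP h hRπ
      (liebWuSigmaAt_le_liebWuSigma0 hU (hP.trans h) hRπ)).1 x

/-- **Lemma 3 at `B = ∞`: `ρ_Q(k) > 0` for all real `k`** (`ρ_Q(k) ≥ ρ₀(k) > 0` where `cos k ≤ 0`,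
`ρ_Q(k) ≥ 1/2π` where `cos k ≥ 0`). [cite: LiebWuPhysicaA2003, §5, Lemma 3] -/
theorem liebWuRhoAt_pos (hU : 0 < U) (hQ : 0 < Q) (hQπ : Q ≤ π) (k : ℝ) : 0 < liebWuRhoAt U Q k := by
  have hc : 0 < U / 4 := by positivity
  have hσi := integrable_liebWuSigmaAt hU hQ
  have hG0 : 0 ≤ ∫ t, liebWuSigmaAt U Q t * cauchyDensity (U / 4) (Real.sin k - t) :=
    integral_nonneg fun t => mul_nonneg (liebWuSigmaAt_pos hU hQ t).le (cauchyDensity_pos hc _).le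
  unfold liebWuRhoAt
  rcases le_or_gt 0 (Real.cos k) with hk | hk
  · have := mul_nonneg hk hG0
    positivity
  · have hle := mul_le_mul_of_nonpos_left (conv_cauchyDensity_mono hU hσi (integrable_liebWuSigma0 hU)
      (liebWuSigmaAt_le_liebWuSigma0 hU hQ hQπ) (Real.sin k)) hk.le
    have hρ := liebWuRho0_pos hU k
    rw [liebWuRho0_eq_conv hU k] at hρ
    linarith

/-- **Theorem 3 at `B = ∞`: `Q ↦ N/N_a` is strictly increasing on `(0, π]`** (hence so is
`M/N_a = ½ N/N_a`). [cite: LiebWuPhysicaA2003, §5, Theorem 3] -/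
theorem liebWuFillingAtCutoff_strictMonoOn (hU : 0 < U) :
    StrictMonoOn (liebWuFillingAtCutoff U) (Ioc 0 π) := by
  intro P hP R hR hPR
  rw [liebWuFillingAtCutoff_eq_two_mul_integral hU hP.1 hP.2,
    liebWuFillingAtCutoff_eq_two_mul_integral hU hR.1 hR.2]
  have := (liebWuSigmaAt_le_of_lt hU hP.1 hPR hR.2 (liebWuSigmaAt_le_liebWuSigma0 hU hR.1 hR.2)).2
  linarith

/-- **`N/N_a < 1` if `Q < π`** (and `= 1` at `Q = π`, `liebWuFillingAtCutoff_pi`).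
[cite: LiebWuPhysicaA2003, §5, Theorem 3] -/
theorem liebWuFillingAtCutoff_lt_one (hU : 0 < U) (hQ : 0 < Q) (hQπ : Q < π) :
    liebWuFillingAtCutoff U Q < 1 := by
  have h := liebWuFillingAtCutoff_strictMonoOn hU ⟨hQ, hQπ.le⟩ ⟨Real.pi_pos, le_rfl⟩ hQπ
  rwa [liebWuFillingAtCutoff_pi hU] at h

/-- `N/N_a ≤ 1`. [cite: LiebWuPhysicaA2003, §5, Theorem 3] -/
theorem liebWuFillingAtCutoff_le_one (hU : 0 < U) (hQ : 0 < Q) (hQπ : Q ≤ π) :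
    liebWuFillingAtCutoff U Q ≤ 1 := by
  rcases eq_or_lt_of_le hQπ with h | h
  · rw [h, liebWuFillingAtCutoff_pi hU]
  · exact (liebWuFillingAtCutoff_lt_one hU hQ h).le

/-- **The cutoff at a given density is unique:** if `N/N_a(Q) = n` then `Q = liebWuCutoffAtFilling U n`.
[cite: LiebWuPhysicaA2003, §5, Theorem 3] -/
theorem liebWuCutoffAtFilling_eq_of_filling_eq (hU : 0 < U) (hQ : Q ∈ Ioc (0 : ℝ) π) {n : ℝ}
    (hn : liebWuFillingAtCutoff U Q = n) : liebWuCutoffAtFilling U n = Q := by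
  have hn' : n ∈ Ioc (0 : ℝ) 1 := by
    rw [← hn]
    exact ⟨liebWuFillingAtCutoff_pos hU hQ.1 hQ.2, liebWuFillingAtCutoff_le_one hU hQ.1 hQ.2⟩
  exact (liebWuFillingAtCutoff_strictMonoOn hU).injOn (liebWuCutoffAtFilling_mem_Ioc hU hn') hQ
    ((liebWuCutoffAtFilling_spec hU hn').2.trans hn.symm)

/-- A density carried by `IsLiebWuEnergyAt` lies in `(0, 1]`. [cite: LiebWuPhysicaA2003, §5, Theorem 3] -/
theorem IsLiebWuEnergyAt.density_mem_Ioc (hU : 0 < U) {n e : ℝ} (h : IsLiebWuEnergyAt U n e) :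
    n ∈ Ioc (0 : ℝ) 1 := by
  obtain ⟨Q, hQ0, hQπ, hQn, -⟩ := (isLiebWuEnergyAt_iff_cutoff hU).1 h
  rw [← hQn]
  exact ⟨liebWuFillingAtCutoff_pos hU hQ0 hQπ, liebWuFillingAtCutoff_le_one hU hQ0 hQπ⟩

/-- **The Lieb–Wu energy at density `n` is single-valued:** for `U > 0` and `0 < n ≤ 1`,
`IsLiebWuEnergyAt U n e ↔ e = liebWuEnergyAtFilling U n`. [cite: LiebWuPRL1968, statements (a)–(c)] -/
theorem isLiebWuEnergyAt_iff_eq_liebWuEnergyAtFilling (hU : 0 < U) {n e : ℝ} (hn : n ∈ Ioc (0 : ℝ) 1) :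
    IsLiebWuEnergyAt U n e ↔ e = liebWuEnergyAtFilling U n := by
  constructor
  · intro h
    obtain ⟨Q, hQ0, hQπ, hQn, hQe⟩ := (isLiebWuEnergyAt_iff_cutoff hU).1 h
    rw [← hQe, liebWuEnergyAtFilling, liebWuCutoffAtFilling_eq_of_filling_eq hU ⟨hQ0, hQπ⟩ hQn]
  · rintro rfl
    exact isLiebWuEnergyAt_liebWuEnergyAtFilling hU hn

end Monotone

end Literature.MathematicalPhysics.QuantumLattice

end
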